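import Mathlib
import HarnessLib
import Summits.ValiantsHypothesis.ValiantsHypothesis.Theses.ChowBorderDepth3

/-!
# Route ChowBorderDepth3 — length-two LOCAL border witnesses from Waring decompositions

Support file for item `stmt-ValiantsHypothesis-6916` (`BStableWitnessBound`, informal) of route
`ValiantsHypothesis/ChowBorderDepth3`, calibrating its first rung ("no short torus-stable smoothable
witness at the vertex `x_0^D`") and the typed item `LocalFanInTwo` (`stmt-ValiantsHypothesis-5938`):
the degree bound `D ≤ (n+2)^(c⌊√n⌋+c)` in those items is load-bearing.

Kumar's universality of border depth-three circuits with top fan-in two (M. Kumar, *On the power of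
border of depth-3 arithmetic circuits*, ACM Trans. Comput. Theory 12 (2020), doi:10.1145/3371506,
main theorem of §1: every form is in the border of top-fan-in-TWO depth-3 circuits of formal degree
`deg · (Waring rank)`; the ECCC version arXiv:1804.03303v1, Thm. 4, has top fan-in `d+1`), written
in the ε-algebra vocabulary of the route.  If
`f = Σ_{i<s} L_i^n` is a sum of `n`-th powers of `s` linear forms over `ℂ` (`n ≥ 1`) and `ζ` is a
primitive `n`-th root of unity, then in `ℂ[ε][x]`

  `1 - Π_{i<s} Π_{k<n} (1 - ζ^k · ε · L_i) = 1 - Π_{i<s} (1 - ε^n L_i^n) = ε^n · f + ε^(n+1) · G`,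

i.e. a TWO-summand border expression `Σ_{i<2} a_i(ε) Π_{j < s·n} (1 + m_ij(ε))` whose linear parts
`m_ij` are all divisible by `ε` (LOCAL at the vertex: every affine factor degenerates to the
constant `1`), with `D = s · n` factors (`exists_local_two_summand_of_sum_of_powers`).
Geometrically: the pair of points `{x_0^D, Π_{i,k}(x_0 - ζ^k ε L_i)}` of the Chow variety `Ch_D`
converges in `Hilb_2` to the torus-stable double point at the vertex `x_0^D` with tangent direction
the padded form `x_0^(D-n) f`, which is therefore SMOOTHABLE in `Ch_D` and has `x_0^(D-n) f` in its
span — a length-2 witness as soon as `D ≥ n · (Waring rank of f)`.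

Consequences recorded here:
* `exists_local_two_summand_perPoly` — the same for `f = per_n` and any Waring decomposition of it;
* `choose_sq_le_of_localFanInTwo` — hence `LocalFanInTwo` is a Waring-rank statement in disguise:
  it forces `C(n,⌊n/2⌋)² ≤ 2·s·n` for every Waring decomposition `per_n = Σ_{i<s} L_i^n`.

No new definitions.  References: Kumar 2020 (doi:10.1145/3371506), §1; J. M. Landsberg,
*Geometry and complexity theory*, CUP 2017, §7.5 (padded Chow rank and depth three).
-/

set_option linter.dupNamespace false

namespace Summit.ValiantsHypothesis.ValiantsHypothesis.Theorems

open Summit.ValiantsHypothesis.ValiantsHypothesis.Theses.ChowBorderDepth3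

open scoped Polynomial

/-- First-order expansion of a product of perturbations of `1`:
`Π_{i ∈ t} (1 - E·A_i) = 1 - E·Σ_{i ∈ t} A_i + E²·H` for some `H`. [folklore] -/
theorem exists_prod_one_sub_mul_eq {R ι : Type*} [CommRing R] (t : Finset ι) (E : R) (A : ι → R) :
    ∃ H : R, ∏ i ∈ t, (1 - E * A i) = 1 - E * ∑ i ∈ t, A i + E ^ 2 * H := by
  classical
  induction t using Finset.induction_on with
  | empty => exact ⟨0, by simp⟩
  | insert j t hj ih =>
    obtain ⟨H, hH⟩ := ih
    refine ⟨A j * ∑ i ∈ t, A i + H - E * A j * H, ?_⟩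
    rw [Finset.prod_insert hj, Finset.sum_insert hj, hH]
    ring

/-- Cyclotomic factorisation at the vertex: for a primitive `n`-th root of unity `ζ` of a domain
`R` (`n ≥ 1`) and any `y ∈ R`, `Π_{k<n} (1 - ζ^k y) = 1 - y^n` (evaluate
`X^n - C (y^n) = Π_{k<n} (X - C (ζ^k y))` at `X = 1`). [folklore] -/
theorem prod_one_sub_pow_mul_eq {R : Type*} [CommRing R] [IsDomain R] {ζ : R} {n : ℕ}
    (hζ : IsPrimitiveRoot ζ n) (hn : 0 < n) (y : R) :
    ∏ k ∈ Finset.range n, (1 - ζ ^ k * y) = 1 - y ^ n := by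
  have h := congrArg (Polynomial.eval (1 : R)) (X_pow_sub_C_eq_prod hζ hn (rfl : y ^ n = y ^ n))
  simpa [Polynomial.eval_prod] using h.symm

/-- **Kumar's identity, abstract form**: in a domain with a primitive `n`-th root of unity `ζ`
(`n ≥ 1`), for any `ε` and `L_0, …, L_{s-1}`,
`1 - Π_{(i,k) ∈ [s]×[n]} (1 - ζ^k ε L_i) = ε^n Σ_i L_i^n + ε^(n+1) H` for some `H`.
[cite: Kumar2020, Sec. 1 main theorem: top fan-in two] -/
theorem exists_one_sub_prod_prod_eq {R : Type*} [CommRing R] [IsDomain R] {ζ : R} {n : ℕ}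
    (hζ : IsPrimitiveRoot ζ n) (hn : 0 < n) (s : ℕ) (ε : R) (L : Fin s → R) :
    ∃ H : R, 1 - ∏ p : Fin s × Fin n, (1 - ζ ^ (p.2 : ℕ) * (ε * L p.1)) =
      ε ^ n * ∑ i, L i ^ n + ε ^ (n + 1) * H := by
  have hinner : ∀ i : Fin s, ∏ k : Fin n, (1 - ζ ^ (k : ℕ) * (ε * L i)) = 1 - ε ^ n * L i ^ n := by
    intro i
    rw [Fin.prod_univ_eq_prod_range (fun k => 1 - ζ ^ k * (ε * L i)) n,
      prod_one_sub_pow_mul_eq hζ hn, mul_pow]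
  obtain ⟨H, hH⟩ :=
    exists_prod_one_sub_mul_eq (Finset.univ : Finset (Fin s)) (ε ^ n) (fun i => L i ^ n)
  have hsq : (ε ^ n) ^ 2 = ε ^ (n + 1) * ε ^ (n - 1) := by
    rw [← pow_mul, ← pow_add]; congr 1; omega
  refine ⟨-(ε ^ (n - 1) * H), ?_⟩
  rw [Fintype.prod_prod_type]
  simp_rw [hinner]
  rw [hH]
  linear_combination (-H) * hsq

/-- **Kumar's top-fan-in-two universality, local form** (doi:10.1145/3371506, §1, in the
route's ε-algebra vocabulary): a sum of `s` `n`-th powers of linear forms (`n ≥ 1`) has a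
two-summand border expression `Σ_{i<2} a_i(ε) · Π_{j<s·n} (1 + m_ij(ε)) = ε^q·f + ε^(q+1)·G` in which
every linear part `m_ij` is divisible by `ε` (all `s·n` affine factors degenerate to the constant
`1`).  Witness: `a = (-1, 1)`, `m_0,(i,k) = -ζ^k ε L_i`, `m_1,j = 0`, `q = n`.
[cite: Kumar2020, Sec. 1 main theorem: top fan-in two] -/
theorem exists_local_two_summand_of_sum_of_powers {σ : Type*} [Fintype σ]
    (n s : ℕ) (hn : 1 ≤ n) (ℓ : Fin s → σ → ℂ) :
    ∃ (q : ℕ) (a : Fin 2 → ℂ[X]) (m : Fin 2 → Fin (s * n) → σ → ℂ[X])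
      (G : MvPolynomial σ ℂ[X]),
      (∀ i j v, Polynomial.X ∣ m i j v) ∧
      (∑ i, MvPolynomial.C (a i) * ∏ j, (1 + ∑ v, MvPolynomial.C (m i j v) * MvPolynomial.X v)) =
        MvPolynomial.C (Polynomial.X ^ q) *
            MvPolynomial.map Polynomial.C
              (∑ i, (∑ v, MvPolynomial.C (ℓ i v) * MvPolynomial.X v) ^ n) +
          MvPolynomial.C (Polynomial.X ^ (q + 1)) * G := by
  classical
  have hn0 : 0 < n := hn
  obtain ⟨ζ, hζ⟩ : ∃ ζ : ℂ, IsPrimitiveRoot ζ n := ⟨_, Complex.isPrimitiveRoot_exp n (by omega)⟩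
  -- the scalar embedding `ℂ → ℂ[ε][x]` transports the primitive root
  have hφ : Function.Injective ((MvPolynomial.C (σ := σ) (R := ℂ[X])).comp Polynomial.C) :=
    (MvPolynomial.C_injective σ ℂ[X]).comp Polynomial.C_injective
  have hζR : IsPrimitiveRoot (MvPolynomial.C (σ := σ) (Polynomial.C ζ)) n :=
    hζ.map_of_injective hφ
  -- Kumar's identity for `ε := C X` and `L i := Σ_v ℓ_iv x_v`
  obtain ⟨H, hH⟩ := exists_one_sub_prod_prod_eq hζR hn0 s (MvPolynomial.C Polynomial.X)
    (fun i => ∑ v, MvPolynomial.C (Polynomial.C (ℓ i v)) * MvPolynomial.X v)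
  -- the witness
  let e : Fin (s * n) ≃ Fin s × Fin n := finProdFinEquiv.symm
  let m₀ : Fin (s * n) → σ → ℂ[X] :=
    fun j v => -(Polynomial.C (ζ ^ ((e j).2 : ℕ) * ℓ (e j).1 v) * Polynomial.X)
  refine ⟨n, ![-1, 1], ![m₀, fun _ _ => 0], H, ?_, ?_⟩
  · intro i j v
    fin_cases i
    · show Polynomial.X ∣ m₀ j v
      exact ⟨-(Polynomial.C (ζ ^ ((e j).2 : ℕ) * ℓ (e j).1 v)), by simp only [m₀]; ring⟩
    · show Polynomial.X ∣ 0
      exact dvd_zero _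
  · -- each affine factor of summand 0 is `1 - ζ^k ε L_i`
    have hfac : ∀ j : Fin (s * n),
        (1 + ∑ v, MvPolynomial.C (m₀ j v) * MvPolynomial.X v) =
          1 - MvPolynomial.C (Polynomial.C ζ) ^ ((e j).2 : ℕ) * (MvPolynomial.C Polynomial.X *
            ∑ v, MvPolynomial.C (Polynomial.C (ℓ (e j).1 v)) * MvPolynomial.X v) := by
      intro j
      rw [sub_eq_add_neg, add_right_inj, Finset.mul_sum, Finset.mul_sum, ← Finset.sum_neg_distrib]
      refine Finset.sum_congr rfl fun v _ => ?_
      simp only [m₀, map_neg, map_mul, map_pow]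
      ring
    -- summand 0: reindex the product over `Fin (s*n)` by `Fin s × Fin n`
    have hprod0 : ∏ j, (1 + ∑ v, MvPolynomial.C (m₀ j v) * MvPolynomial.X v) =
        ∏ p : Fin s × Fin n, (1 - MvPolynomial.C (Polynomial.C ζ) ^ (p.2 : ℕ) *
          (MvPolynomial.C Polynomial.X *
            ∑ v, MvPolynomial.C (Polynomial.C (ℓ p.1 v)) * MvPolynomial.X v)) := by
      simp_rw [hfac]
      exact Fintype.prod_equiv e _ _ fun j => rfl
    -- the right-hand side
    have hmap : MvPolynomial.map Polynomial.C
        (∑ i, (∑ v, MvPolynomial.C (ℓ i v) * MvPolynomial.X v) ^ n) =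
          ∑ i, (∑ v, MvPolynomial.C (Polynomial.C (ℓ i v)) * MvPolynomial.X v) ^ n := by
      simp [map_sum, map_pow, map_mul, MvPolynomial.map_C, MvPolynomial.map_X]
    rw [Fin.sum_univ_two]
    simp only [Matrix.cons_val_zero, Matrix.cons_val_one, map_neg, map_one, map_zero, zero_mul,
      Finset.sum_const_zero, add_zero, Finset.prod_const_one, mul_one, hprod0, hmap, map_pow]
    linear_combination hH

/-- **Length-two local witnesses for the permanent** (calibration of the first rung of
`BStableWitnessBound`, item stmt-ValiantsHypothesis-6916, and of `LocalFanInTwo`, item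
stmt-ValiantsHypothesis-5938): every Waring decomposition `per_n = Σ_{i<s} L_i^n` (`n ≥ 1`) yields
a two-summand LOCAL border expression of `per_n` with `D = s·n` affine factors — so the degree
bound `D ≤ (n+2)^(c⌊√n⌋+c)` in those items cannot be dropped. [cite: Kumar2020, Sec. 1 main theorem: top fan-in two] -/
theorem exists_local_two_summand_perPoly (n s : ℕ) (hn : 1 ≤ n)
    (ℓ : Fin s → (Fin n × Fin n) → ℂ)
    (hW : Literature.Computability.AlgebraicComplexity.perPoly (Fin n) ℂ =
      ∑ i, (∑ v, MvPolynomial.C (ℓ i v) * MvPolynomial.X v) ^ n) :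
    ∃ (q : ℕ) (a : Fin 2 → ℂ[X]) (m : Fin 2 → Fin (s * n) → (Fin n × Fin n) → ℂ[X])
      (G : MvPolynomial (Fin n × Fin n) ℂ[X]),
      (∀ i j v, Polynomial.X ∣ m i j v) ∧
      (∑ i, MvPolynomial.C (a i) * ∏ j, (1 + ∑ v, MvPolynomial.C (m i j v) * MvPolynomial.X v)) =
        MvPolynomial.C (Polynomial.X ^ q) *
            MvPolynomial.map Polynomial.C
              (Literature.Computability.AlgebraicComplexity.perPoly (Fin n) ℂ) +
          MvPolynomial.C (Polynomial.X ^ (q + 1)) * G := by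
  rw [hW]
  exact exists_local_two_summand_of_sum_of_powers n s hn ℓ

/-- **`LocalFanInTwo` is a Waring-rank bound in disguise**: combined with Kumar's length-two local
witnesses it forces `C(n,⌊n/2⌋)² ≤ 2·(s·n)` for every Waring decomposition of `per_n` of length `s`
(`n ≥ 1`); equivalently, the first rung of `BStableWitnessBound` at length `2` can only hold in the
range `2·D < C(n,⌊n/2⌋)²`-ish and does fail from `D = n · WaringRank(per_n)` on.
[cite: Kumar2020, Sec. 1 main theorem: top fan-in two] -/
theorem choose_sq_le_of_localFanInTwo (hLFT : LocalFanInTwo) (n s : ℕ) (hn : 1 ≤ n)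
    (ℓ : Fin s → (Fin n × Fin n) → ℂ)
    (hW : Literature.Computability.AlgebraicComplexity.perPoly (Fin n) ℂ =
      ∑ i, (∑ v, MvPolynomial.C (ℓ i v) * MvPolynomial.X v) ^ n) :
    (n.choose (n / 2)) ^ 2 ≤ 2 * (s * n) := by
  obtain ⟨q, a, m, G, hdiv, hsum⟩ := exists_local_two_summand_perPoly n s hn ℓ hW
  exact hLFT n (s * n) q a m G hn hdiv hsum

end Summit.ValiantsHypothesis.ValiantsHypothesis.Theorems
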